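import Summits.HodgeConjecture.CorCM.GaloisCertificateTimesCyclic
import Mathlib.GroupTheory.SemidirectProduct
import HarnessLib

/-!
# BAD is monotone along SPLIT extensions: a certificate for the quotient `Q` of `G = N ⋊ Q` lifts to `G` whenever
# `|N| ≥ 3` and complex conjugation lies in the complement

COR-CM (cell `pub-hodgecm2`), binder seat b04 (gen 31), count-neutral own lane «Galois-CM-type classification» (which Galois
CM fields `(G, c)` have ALL primitive CM types nondegenerate = GOOD, vs. a primitive degenerate type = BAD).  KERNEL ONLY:
theorems; no definition, no named fact, no `sorry`.  `HC_CM` is neither used nor claimed.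

THE SETTING.  A finite group `G` given as a SPLIT EXTENSION: homomorphisms `f : G →* Q` and `σ : Q →* G` with `f ∘ σ = id`
(so `G = ker f ⋊ σ(Q)`; every `x ∈ G` is uniquely `x = σ(f x) · ν(x)` with `ν(x) = σ(f x)⁻¹ x ∈ ker f`), two distinct
non-trivial elements `n₁, n₂ ∈ ker f` (`|ker f| ≥ 3`), and an ANNIHILATOR CERTIFICATE `(T₀, b₀)` for `(Q, c₀)` in the format of
gen 24 `CorCM/GaloisAnnihilatorCertificates`: `T₀ ⊂ Q` a CM set for `c₀` (`q ∈ T₀ ↔ c₀ q ∉ T₀`) with trivial LEFT stabiliser,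
`b₀ : Q → ℤ` non-zero, `c₀`-antisymmetric and annihilated by all RIGHT translates of `T₀` (`Σ_{s ∈ T₀} b₀(s g) = 0`).

THE LIFT (§1).  `S = {x ∈ G : f x ∈ T₀ ↔ ν(x) ≠ n₁}` — i.e. on the coset `σ(Q)·n` of the complement the set `σ(T₀) n` for
`n ≠ n₁` and its complement `σ(c₀ T₀) n₁` on the single coset `σ(Q) n₁` — and `b(x) = b₀(f x)` on `σ(Q)`, `0` elsewhere.  Then:
* `S` is a CM set for `c = σ(c₀)` (`mem_lift_cm`: `ν(σ(c₀) x) = ν(x)`);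
* `S` has trivial left stabiliser (`lift_leftStabiliser`): a period `v` with `f v ≠ 1` is tested on `w = σ(q) n` where `q`
  witnesses `f(v)·T₀ ≠ T₀` and `n ∈ {1, n₂}` is chosen with `n ≠ n₁` and `ν(v w) ≠ n₁` (this is where `|ker f| ≥ 3` enters);
  a period `v ∈ ker f ∖ 1` is refuted by `w = v⁻¹ n₁`, whose membership flips under `v`;
* `b` is `c`-antisymmetric, non-zero, and ANNIHILATED by every right translate of `S` (`lift_annihilated`): `S g ∩ σ(Q)`
  consists of the `σ(q) n g` with `n = σ(f g) g⁻¹`, i.e. it is `σ(T₀ · f g)` or `σ(c₀ T₀ · f g)`, on which `b` sums to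
  `Σ_{T₀} b₀(· f g) = 0` resp. `Σ_Q b₀ − Σ_{T₀} b₀ = 0`.
So `(S, b)` is an annihilator certificate for `(G, σ c₀)` (`exists_lift_certificate`) — with NO hypothesis on `Q`, on `ker f`
(beyond `|ker f| ≥ 3`) or on the action.  (For `|ker f| = 2`, i.e. `G = Q × C₂`, the lift needs a side condition and can fail:
`Q₈ × C₂` is GOOD — see `CorCM/GaloisCertificateTimesTwo` and `CorCM/GaloisIndexTwoTimesTwo`.)

THE THEOREMS (§2, `K` a Galois CM field).
* **`exists_simple_degenerate_of_split_certificate`**: `e : Gal(K/ℚ) ≃* G₀` with `G₀` split over `Q₀` as above, complex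
  conjugation `σ(c₀)`, `|ker f| ≥ 3`, and an annihilator certificate for `(Q₀, c₀)` ⟹ `K` carries a SIMPLE DEGENERATE abelian
  variety of dimension `|G₀|/2` with CM by `K` (a rational `(p,p)` class outside the divisor ring on some power).  In field
  terms: if `K ⊇ K₀ ⊇ ℚ` with `K₀` Galois CM, `Gal(K/ℚ) → Gal(K₀/ℚ)` SPLIT by a complement containing complex conjugation
  (e.g. `K = K₀ L` with `L` totally real, `K₀ ∩ L = ℚ`) and `[K : K₀] ≥ 3`, then a certified-BAD `K₀` makes `K` BAD.
* **`exists_simple_degenerate_prod_of_certificate`**: `Gal(K/ℚ) ≃* Γ₀ × H` for ANY finite group `H` with `|H| ≥ 3`, complex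
  conjugation `(c₀, 1)`, certificate for `(Γ₀, c₀)` ⟹ BAD (gen 30's `exists_simple_degenerate_prod_cyclic_of_certificate` is
  the case `H = C_n`).
* **`exists_simple_degenerate_semidirect_of_certificate`**: `Gal(K/ℚ) ≃* N ⋊[φ] Γ₀` (Mathlib `SemidirectProduct`, any action
  `φ`, `|N| ≥ 3`), complex conjugation `inr c₀`, certificate for `(Γ₀, c₀)` ⟹ BAD: e.g. `C_p ⋊ Γ₀`, `C_p² ⋊ Γ₀`, `S₃ × Γ₀`, …
  for every certified-BAD `Γ₀` (`D₁₆`, `SD₃₂`, `M₃₂`, `ℤ/8 × ℤ/2` with `c ∉ ℤ/8`, the order-24/32 rows, the `C_p ⋊ C₈` and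
  `Q₈ × C_p` norm-pair certificates, …).
Position: gen 24's REAL-FACTOR / COMPLEMENT theorems (`GaloisRealFactorDegenerate`, `GaloisRealFactorComplement`) make
`N ⋊ Γ'` BAD from the KERNEL side (`N ∉ {1, C₂, C₂², C₂³, C₄, C_p, S₃}`, given only a primitive type of `Γ'`); this file makes
it BAD from the QUOTIENT side (any `N` with `|N| ≥ 3`, given a certificate for `Γ'`).  Seat numerics `scratch/split_monotone.py`
(`C₃ ⋊ (ℤ/8×ℤ/2)`, `S₃ × (ℤ/8×ℤ/2)`, `C₃ ⋊ D₁₀`: ranks `22 < 25`, `43 < 49`, `28 < 31`).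

## References

* [Kubota1965] T. Kubota, *On the field extension by complex multiplication*, Trans. AMS 118 (1965), §2, §4 Lemma 2.
* [Shimura1998] G. Shimura, *Abelian Varieties with Complex Multiplication and Modular Functions*, §6.2 Thm. 3, §8.2 Prop. 26.
* [Gordon1999HodgeAVSurvey] B. B. Gordon, *A survey of the Hodge conjecture for abelian varieties*, Thm. 6.4, §9.3.
-/

noncomputable section

open CategoryTheory CategoryTheory.Limits NumberField
open scoped BigOperators

namespace Summit.HodgeConjecture.CorCM.GaloisModels

open Literature.NumberTheory.ComplexMultiplication
open Literature.AlgebraicGeometry.Motives (AbelianVariety CMType)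
open Literature.AlgebraicGeometry.HodgeTheory
open Literature.AlgebraicGeometry.ComplexMultiplication (IsCMTypeRealisation)
open Literature.AlgebraicGeometry.Pohlmann1968
open Literature.Barriers.HodgeConjecture (divisorClassesSpan)

namespace SplitExtension

section Model

variable {G Q : Type*} [Group G] [Group Q] {f : G →* Q} {σ : Q →* G}

/-! ## §1 The lift of a certificate along a split extension `f : G →* Q`, `σ : Q →* G`, `f ∘ σ = id` -/

/-- The `ker f`-component `ν(x) = σ(f x)⁻¹ x` lies in `ker f`. [folklore] -/
theorem map_kerPart (hfσ : ∀ q, f (σ q) = q) (x : G) : f ((σ (f x))⁻¹ * x) = 1 := by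
  rw [map_mul, map_inv, hfσ, inv_mul_cancel]

/-- `ν(σ(q) x) = ν(x)`: left multiplication by the complement does not change the `ker f`-component. [folklore] -/
theorem kerPart_sigma_mul (hfσ : ∀ q, f (σ q) = q) (q : Q) (x : G) :
    (σ (f (σ q * x)))⁻¹ * (σ q * x) = (σ (f x))⁻¹ * x := by
  rw [map_mul, hfσ, map_mul, mul_inv_rev, mul_assoc, inv_mul_cancel_left]

/-- Coordinates: `f (σ(q) n) = q` for `n ∈ ker f`. [folklore] -/
theorem map_sigma_mul (hfσ : ∀ q, f (σ q) = q) (q : Q) {n : G} (hn : f n = 1) : f (σ q * n) = q := by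
  rw [map_mul, hfσ, hn, mul_one]

/-- Coordinates: `ν(σ(q) n) = n` for `n ∈ ker f`. [folklore] -/
theorem kerPart_sigma_mul_of_ker (hfσ : ∀ q, f (σ q) = q) (q : Q) {n : G} (hn : f n = 1) :
    (σ (f (σ q * n)))⁻¹ * (σ q * n) = n := by
  rw [map_sigma_mul hfσ q hn, inv_mul_cancel_left]

/-- The product formula `v · σ(q) n = σ(f(v) q) · (σ(q)⁻¹ ν(v) σ(q) n)`. [folklore] -/
theorem mul_sigma_mul (v : G) (q : Q) (n : G) :
    v * (σ q * n) = σ (f v * q) * ((σ q)⁻¹ * ((σ (f v))⁻¹ * v) * σ q * n) := by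
  rw [map_mul]; group

/-- … whose second factor lies in `ker f`. [folklore] -/
theorem map_conj_kerPart_mul (hfσ : ∀ q, f (σ q) = q) (v : G) (q : Q) {n : G} (hn : f n = 1) :
    f ((σ q)⁻¹ * ((σ (f v))⁻¹ * v) * σ q * n) = 1 := by
  simp only [map_mul, map_inv, hfσ, hn, inv_mul_cancel, mul_one, inv_mul_cancel]

variable [Fintype G] [DecidableEq G] [DecidableEq Q]

/-- Membership in the lifted set `S = {x : f x ∈ T₀ ↔ ν(x) ≠ n₁}`. [folklore] -/
theorem mem_lift_iff (T₀ : Finset Q) (n₁ x : G) :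
    x ∈ (Finset.univ.filter fun y : G => (f y ∈ T₀ ↔ (σ (f y))⁻¹ * y ≠ n₁)) ↔
      (f x ∈ T₀ ↔ (σ (f x))⁻¹ * x ≠ n₁) := by
  rw [Finset.mem_filter, and_iff_right (Finset.mem_univ x)]

/-- Membership in coordinates: `σ(q) n ∈ S ↔ (q ∈ T₀ ↔ n ≠ n₁)` for `n ∈ ker f`. [folklore] -/
theorem sigma_mul_mem_lift_iff (hfσ : ∀ q, f (σ q) = q) (T₀ : Finset Q) (n₁ : G) (q : Q) {n : G} (hn : f n = 1) :
    σ q * n ∈ (Finset.univ.filter fun y : G => (f y ∈ T₀ ↔ (σ (f y))⁻¹ * y ≠ n₁)) ↔ (q ∈ T₀ ↔ n ≠ n₁) := by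
  rw [mem_lift_iff, kerPart_sigma_mul_of_ker hfσ q hn, map_sigma_mul hfσ q hn]

/-- **The lifted set is a CM set for `σ(c₀)`.** [cite: Shimura1998, §18.2 Lemma (i)] -/
theorem mem_lift_cm (hfσ : ∀ q, f (σ q) = q) (c₀ : Q) (T₀ : Finset Q) (hcm : ∀ q : Q, q ∈ T₀ ↔ c₀ * q ∉ T₀)
    (n₁ x : G) :
    x ∈ (Finset.univ.filter fun y : G => (f y ∈ T₀ ↔ (σ (f y))⁻¹ * y ≠ n₁)) ↔
      σ c₀ * x ∉ (Finset.univ.filter fun y : G => (f y ∈ T₀ ↔ (σ (f y))⁻¹ * y ≠ n₁)) := by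
  rw [mem_lift_iff, mem_lift_iff, kerPart_sigma_mul hfσ, map_mul, hfσ]
  have h := hcm (f x)
  tauto

/-- **The lifted set has trivial left stabiliser** (here `|ker f| ≥ 3` is used, through two distinct non-trivial
`n₁, n₂ ∈ ker f`). [cite: Shimura1998, §8.2 Prop. 26] -/
theorem lift_leftStabiliser (hfσ : ∀ q, f (σ q) = q) {n₁ n₂ : G} (hn₁ : f n₁ = 1) (hn₂ : f n₂ = 1) (h₁ : n₁ ≠ 1)
    (h₂ : n₂ ≠ 1) (h₁₂ : n₁ ≠ n₂) (T₀ : Finset Q) (hprim : ∀ v : Q, v ≠ 1 → ∃ w : Q, ¬ (w ∈ T₀ ↔ v * w ∈ T₀))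
    (v : G) (hv : v ≠ 1) :
    ∃ w : G, ¬ (w ∈ (Finset.univ.filter fun y : G => (f y ∈ T₀ ↔ (σ (f y))⁻¹ * y ≠ n₁)) ↔
      v * w ∈ (Finset.univ.filter fun y : G => (f y ∈ T₀ ↔ (σ (f y))⁻¹ * y ≠ n₁))) := by
  by_cases hfv : f v = 1
  · -- `v ∈ ker f ∖ 1`: the membership of `w = v⁻¹ n₁ = σ(1)·(v⁻¹ n₁)` flips under `v` (`v w = σ(1)·n₁`)
    have hw : f (v⁻¹ * n₁) = 1 := by rw [map_mul, map_inv, hfv, hn₁, inv_one, one_mul]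
    have hne : v⁻¹ * n₁ ≠ n₁ := by
      intro h
      apply hv
      have h' : v⁻¹ = 1 := mul_right_cancel (h.trans (one_mul n₁).symm)
      exact inv_eq_one.1 h'
    refine ⟨σ 1 * (v⁻¹ * n₁), ?_⟩
    rw [map_one, one_mul, mul_inv_cancel_left, ← one_mul (v⁻¹ * n₁), ← map_one σ,
      sigma_mul_mem_lift_iff hfσ T₀ n₁ 1 hw, ← one_mul n₁, ← map_one σ, sigma_mul_mem_lift_iff hfσ T₀ _ 1 hn₁, map_one,
      one_mul]
    tauto
  · -- `f v ≠ 1`: test on `w = σ(q) n` with `q` a witness for `f v` and `n ∈ {1, n₂}` avoiding `n₁` twice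
    obtain ⟨q, hq⟩ := hprim (f v) hfv
    set m : G := (σ q)⁻¹ * ((σ (f v))⁻¹ * v) * σ q with hm_def
    obtain ⟨n, hn, hnn₁, hmn⟩ : ∃ n : G, f n = 1 ∧ n ≠ n₁ ∧ m * n ≠ n₁ := by
      by_cases hm : m = n₁
      · refine ⟨n₂, hn₂, h₁₂.symm, fun h => h₂ ?_⟩
        rw [hm] at h
        exact mul_left_cancel (h.trans (mul_one n₁).symm)
      · exact ⟨1, map_one f, h₁.symm, by rwa [mul_one]⟩
    refine ⟨σ q * n, ?_⟩
    rw [sigma_mul_mem_lift_iff hfσ T₀ n₁ q hn, mul_sigma_mul v q n,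
      sigma_mul_mem_lift_iff hfσ T₀ n₁ (f v * q) (n := m * n)
        (by rw [hm_def]; exact map_conj_kerPart_mul hfσ v q hn)]
    tauto

omit [Fintype G] [DecidableEq Q] in
/-- **The lifted weight `b = b₀ ∘ f` on `σ(Q)`, `0` elsewhere, is `σ(c₀)`-antisymmetric.** [folklore] -/
theorem liftWeight_antisymm (hfσ : ∀ q, f (σ q) = q) (c₀ : Q) (b₀ : Q → ℤ) (hanti : ∀ q, b₀ (c₀ * q) = -b₀ q) (x : G) :
    (if σ (f (σ c₀ * x)) = σ c₀ * x then b₀ (f (σ c₀ * x)) else 0) =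
      -(if σ (f x) = x then b₀ (f x) else 0) := by
  have hfx : f (σ c₀ * x) = c₀ * f x := by rw [map_mul, hfσ]
  have hiff : (σ (c₀ * f x) = σ c₀ * x) ↔ σ (f x) = x := by rw [map_mul, mul_right_inj]
  rw [hfx]
  by_cases h : σ (f x) = x
  · rw [if_pos (hiff.2 h), if_pos h, hanti]
  · rw [if_neg (fun h' => h (hiff.1 h')), if_neg h, neg_zero]

omit [Fintype G] [DecidableEq Q] in
/-- **The lifted weight is non-zero** (`b(σ q) = b₀(q)`). [folklore] -/
theorem liftWeight_ne_zero (hfσ : ∀ q, f (σ q) = q) (b₀ : Q → ℤ) (hb : ∃ q, b₀ q ≠ 0) :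
    ∃ x : G, (if σ (f x) = x then b₀ (f x) else 0) ≠ 0 := by
  obtain ⟨q, hq⟩ := hb
  refine ⟨σ q, ?_⟩
  rwa [hfσ, if_pos rfl]

variable [Fintype Q]

/-- **The lifted weight is annihilated by every right translate of the lifted set.**  The translate `S g` meets `σ(Q)` in
the points `σ(q) n g` with `n = σ(f g) g⁻¹`, i.e. in `σ(T₀' · f g)` with `T₀' = T₀` or `Q ∖ T₀` according as `n ≠ n₁` or
`n = n₁`; the sum of `b₀` over it is `0` by the hypothesis resp. by antisymmetry. [cite: Kubota1965, §2] -/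
theorem lift_annihilated (hfσ : ∀ q, f (σ q) = q) (c₀ : Q) (T₀ : Finset Q) (b₀ : Q → ℤ)
    (hanti : ∀ q, b₀ (c₀ * q) = -b₀ q) (hann : ∀ g : Q, ∑ s ∈ T₀, b₀ (s * g) = 0) (n₁ g : G) :
    ∑ s ∈ (Finset.univ.filter fun y : G => (f y ∈ T₀ ↔ (σ (f y))⁻¹ * y ≠ n₁)),
      (if σ (f (s * g)) = s * g then b₀ (f (s * g)) else 0) = 0 := by
  classical
  rw [Finset.sum_ite, Finset.sum_const_zero, add_zero]
  -- the `ker f`-coordinate of the points of `S g ∩ σ(Q)`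
  set n : G := σ (f g) * g⁻¹ with hn_def
  have hn : f n = 1 := by rw [hn_def, map_mul, hfσ, map_inv, mul_inv_cancel]
  have hsg : ∀ q : Q, σ q * n * g = σ (q * f g) := fun q => by
    rw [hn_def, map_mul, mul_assoc, mul_assoc, inv_mul_cancel, mul_one]
  have hset : ((Finset.univ.filter fun y : G => (f y ∈ T₀ ↔ (σ (f y))⁻¹ * y ≠ n₁)).filter
      fun s => σ (f (s * g)) = s * g) =
      (Finset.univ.filter fun q : Q => (q ∈ T₀ ↔ n ≠ n₁)).image fun q => σ q * n := by
    ext s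
    simp only [Finset.mem_filter, Finset.mem_univ, true_and, Finset.mem_image]
    constructor
    · rintro ⟨hmem, hfix⟩
      -- `s = σ(f s) · n`
      have hs : s = σ (f s) * n := by
        rw [map_mul, map_mul] at hfix
        rw [hn_def, ← mul_assoc, eq_mul_inv_iff_mul_eq, hfix]
      refine ⟨f s, ?_, hs.symm⟩
      have hν : (σ (f s))⁻¹ * s = n := by
        conv_lhs => rw [hs]
        exact kerPart_sigma_mul_of_ker hfσ (f s) hn
      rwa [hν] at hmem
    · rintro ⟨q, hq, rfl⟩
      refine ⟨?_, ?_⟩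
      · rwa [kerPart_sigma_mul_of_ker hfσ q hn, map_sigma_mul hfσ q hn]
      · rw [hsg, hfσ]
  rw [hset, Finset.sum_image (fun q₁ _ q₂ _ h => by
    have := congrArg f h
    rwa [map_sigma_mul hfσ q₁ hn, map_sigma_mul hfσ q₂ hn] at this)]
  have hsum : ∀ q : Q, b₀ (f (σ q * n * g)) = b₀ (q * f g) := fun q => by rw [hsg, hfσ]
  simp only [hsum]
  by_cases hn₁ : n = n₁
  · -- the complement of `T₀`
    have hT : (Finset.univ.filter fun q : Q => (q ∈ T₀ ↔ n ≠ n₁)) = Finset.univ.filter fun q : Q => q ∉ T₀ := by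
      ext q; simp [hn₁]
    rw [hT]
    have hsplit := Finset.sum_filter_add_sum_filter_not Finset.univ (fun q : Q => q ∈ T₀) (fun q => b₀ (q * f g))
    rw [sum_eq_zero_of_antisymm c₀ b₀ hanti (f g)] at hsplit
    have hT' : (Finset.univ.filter fun q : Q => q ∈ T₀) = T₀ := by ext q; simp
    rw [hT', hann (f g), zero_add] at hsplit
    exact hsplit
  · have hT : (Finset.univ.filter fun q : Q => (q ∈ T₀ ↔ n ≠ n₁)) = T₀ := by
      ext q; simp [hn₁]
    rw [hT]
    exact hann (f g)

/-- **THE LIFT OF A CERTIFICATE ALONG A SPLIT EXTENSION.**  `f : G →* Q`, `σ : Q →* G`, `f ∘ σ = id`, two distinct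
non-trivial elements of `ker f`, and an annihilator certificate `(T₀, b₀)` for `(Q, c₀)` ⟹ an annihilator certificate
`(S, b)` for `(G, σ c₀)`: a CM set with trivial left stabiliser and a non-zero antisymmetric integer weight annihilated by all
its right translates. [cite: Kubota1965, §2] [cite: Shimura1998, §8.2 Prop. 26] -/
theorem exists_lift_certificate (hfσ : ∀ q, f (σ q) = q) {n₁ n₂ : G} (hn₁ : f n₁ = 1) (hn₂ : f n₂ = 1) (h₁ : n₁ ≠ 1)
    (h₂ : n₂ ≠ 1) (h₁₂ : n₁ ≠ n₂) (c₀ : Q) (T₀ : Finset Q) (hcm : ∀ q : Q, q ∈ T₀ ↔ c₀ * q ∉ T₀)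
    (hprim : ∀ v : Q, v ≠ 1 → ∃ w : Q, ¬ (w ∈ T₀ ↔ v * w ∈ T₀)) (b₀ : Q → ℤ)
    (hanti : ∀ q, b₀ (c₀ * q) = -b₀ q) (hann : ∀ g : Q, ∑ s ∈ T₀, b₀ (s * g) = 0) (hb : ∃ q, b₀ q ≠ 0) :
    ∃ (S : Finset G) (b : G → ℤ), (∀ x : G, x ∈ S ↔ σ c₀ * x ∉ S) ∧
      (∀ v : G, v ≠ 1 → ∃ w : G, ¬ (w ∈ S ↔ v * w ∈ S)) ∧ (∀ x, b (σ c₀ * x) = -b x) ∧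
      (∀ g : G, ∑ s ∈ S, b (s * g) = 0) ∧ ∃ x, b x ≠ 0 :=
  ⟨Finset.univ.filter fun y : G => (f y ∈ T₀ ↔ (σ (f y))⁻¹ * y ≠ n₁),
    fun x => if σ (f x) = x then b₀ (f x) else 0,
    mem_lift_cm hfσ c₀ T₀ hcm n₁, lift_leftStabiliser hfσ hn₁ hn₂ h₁ h₂ h₁₂ T₀ hprim,
    liftWeight_antisymm hfσ c₀ b₀ hanti, lift_annihilated hfσ c₀ T₀ b₀ hanti hann n₁, liftWeight_ne_zero hfσ b₀ hb⟩

end Model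

end SplitExtension

/-! ## §2 The theorems for Galois CM fields -/

section Field

variable {K : Type} [Field K] [NumberField K] [IsCMField K] [IsGalois ℚ K]

/-- **A CERTIFIED-BAD QUOTIENT WITH A COMPLEMENT THROUGH COMPLEX CONJUGATION MAKES THE FIELD BAD.**  `e : Gal(K/ℚ) ≃* G₀`,
`G₀` split over `Q₀` (`f ∘ σ = id`) with `|ker f| ≥ 3` (two distinct non-trivial elements), complex conjugation `= σ(c₀)`,
and an annihilator certificate `(T₀, b₀)` for `(Q₀, c₀)` ⟹ `K` carries a SIMPLE DEGENERATE abelian variety of dimension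
`|G₀|/2` with CM by `K` (rational `(p,p)` class outside the divisor ring on some power).
[cite: Kubota1965, §2 and §4 Lemma 2] [cite: Shimura1998, §6.2 Thm. 3 and §8.2 Prop. 26] [cite: Gordon1999HodgeAVSurvey, Thm. 6.4 and §9.3] -/
theorem exists_simple_degenerate_of_split_certificate {G₀ Q₀ : Type*} [Group G₀] [Fintype G₀] [DecidableEq G₀]
    [Group Q₀] [Fintype Q₀] [DecidableEq Q₀] (e : (K ≃ₐ[ℚ] K) ≃* G₀) (f : G₀ →* Q₀) (σ : Q₀ →* G₀)
    (hfσ : ∀ q, f (σ q) = q) {n₁ n₂ : G₀} (hn₁ : f n₁ = 1) (hn₂ : f n₂ = 1) (h₁ : n₁ ≠ 1) (h₂ : n₂ ≠ 1)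
    (h₁₂ : n₁ ≠ n₂) (c₀ : Q₀) (hc : e ((IsCMField.complexConj K).restrictScalars ℚ) = σ c₀) (T₀ : Finset Q₀)
    (hcm : ∀ q : Q₀, q ∈ T₀ ↔ c₀ * q ∉ T₀) (hprim : ∀ v : Q₀, v ≠ 1 → ∃ w : Q₀, ¬ (w ∈ T₀ ↔ v * w ∈ T₀))
    (b₀ : Q₀ → ℤ) (hanti : ∀ q, b₀ (c₀ * q) = -b₀ q) (hann : ∀ g : Q₀, ∑ s ∈ T₀, b₀ (s * g) = 0)
    (hb : ∃ q, b₀ q ≠ 0) :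
    ∃ (Φ : CMType K) (φ₀ : K →+* ℂ) (X : AbelianVariety ℂ) (ι : 𝓞 K →+* End X)
      (ϑ : K →+* Module.End ℂ (complexBetti X.X 1)),
      IsPrimitive (ℂ ≃+* ℂ) Φ.1 φ₀ ∧ ¬ IsNondegenerate Φ ∧ IsCMTypeRealisation Φ X ι ϑ ∧ X.IsSimple ∧
      X.dim = Fintype.card G₀ / 2 ∧
      ∃ m p : ℕ, ∃ y : complexBetti (⨁ fun _ : Fin m => X).X (2 * p), IsRationalClass y ∧
        IsOfHodgeType (⨁ fun _ : Fin m => X).dim (⨁ fun _ : Fin m => X).X (2 * p) p p y ∧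
        y ∉ divisorClassesSpan (⨁ fun _ : Fin m => X).X (⨁ fun _ : Fin m => X).dim p := by
  obtain ⟨S, b, hcm', hprim', hanti', hann', hb'⟩ :=
    SplitExtension.exists_lift_certificate hfσ hn₁ hn₂ h₁ h₂ h₁₂ c₀ T₀ hcm hprim b₀ hanti hann hb
  exact exists_simple_degenerate_of_model_annihilator e (σ c₀) hc S hcm' hprim' b hanti' hann' hb'

/-- **A CERTIFIED-BAD GROUP STAYS BAD TIMES ANY GROUP OF ORDER `≥ 3`.**  `e : Gal(K/ℚ) ≃* Γ₀ × H`, `H` any finite group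
with `|H| ≥ 3`, complex conjugation `(c₀, 1)`, and an annihilator certificate for `(Γ₀, c₀)` ⟹ `K` carries a simple
degenerate abelian variety of dimension `|Γ₀|·|H|/2` with CM by `K`.  (The `× C_n` theorem of
`CorCM/GaloisCertificateTimesCyclic` is the case `H = C_n`.) [cite: Kubota1965, §2 and §4 Lemma 2]
[cite: Shimura1998, §6.2 Thm. 3 and §8.2 Prop. 26] [cite: Gordon1999HodgeAVSurvey, Thm. 6.4 and §9.3] -/
theorem exists_simple_degenerate_prod_of_certificate {Γ₀ H : Type*} [Group Γ₀] [Fintype Γ₀] [DecidableEq Γ₀]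
    [Group H] [Fintype H] [DecidableEq H] (hH : 2 < Fintype.card H) (e : (K ≃ₐ[ℚ] K) ≃* Γ₀ × H) (c₀ : Γ₀)
    (hc : e ((IsCMField.complexConj K).restrictScalars ℚ) = (c₀, 1)) (T₀ : Finset Γ₀)
    (hcm : ∀ x : Γ₀, x ∈ T₀ ↔ c₀ * x ∉ T₀) (hprim : ∀ v : Γ₀, v ≠ 1 → ∃ w : Γ₀, ¬ (w ∈ T₀ ↔ v * w ∈ T₀))
    (b : Γ₀ → ℤ) (hanti : ∀ y, b (c₀ * y) = -b y) (hann : ∀ g : Γ₀, ∑ s ∈ T₀, b (s * g) = 0) (hb : ∃ y, b y ≠ 0) :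
    ∃ (Φ : CMType K) (φ₀ : K →+* ℂ) (X : AbelianVariety ℂ) (ι : 𝓞 K →+* End X)
      (ϑ : K →+* Module.End ℂ (complexBetti X.X 1)),
      IsPrimitive (ℂ ≃+* ℂ) Φ.1 φ₀ ∧ ¬ IsNondegenerate Φ ∧ IsCMTypeRealisation Φ X ι ϑ ∧ X.IsSimple ∧
      X.dim = Fintype.card Γ₀ * Fintype.card H / 2 ∧
      ∃ m p : ℕ, ∃ y : complexBetti (⨁ fun _ : Fin m => X).X (2 * p), IsRationalClass y ∧
        IsOfHodgeType (⨁ fun _ : Fin m => X).dim (⨁ fun _ : Fin m => X).X (2 * p) p p y ∧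
        y ∉ divisorClassesSpan (⨁ fun _ : Fin m => X).X (⨁ fun _ : Fin m => X).dim p := by
  -- two distinct non-trivial elements of `H`
  obtain ⟨h₁, h₂, hh₁, hh₂, hh₁₂⟩ : ∃ h₁ h₂ : H, h₁ ≠ 1 ∧ h₂ ≠ 1 ∧ h₁ ≠ h₂ := by
    obtain ⟨a, b, c, hab, hac, hbc⟩ := Fintype.two_lt_card_iff.1 hH
    by_cases ha : a = 1
    · exact ⟨b, c, fun h => hab (ha.trans h.symm), fun h => hac (ha.trans h.symm), hbc⟩
    · by_cases hb : b = 1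
      · exact ⟨a, c, ha, fun h => hbc (hb.trans h.symm), hac⟩
      · exact ⟨a, b, ha, hb, hab⟩
  obtain ⟨Φ, φ₀, X, ι, ϑ, H1, H2, H3, H4, H5, H6⟩ :=
    exists_simple_degenerate_of_split_certificate e (MonoidHom.fst Γ₀ H) (MonoidHom.inl Γ₀ H) (fun q => rfl)
      (n₁ := (1, h₁)) (n₂ := (1, h₂)) rfl rfl (fun h => hh₁ (Prod.mk.inj h).2) (fun h => hh₂ (Prod.mk.inj h).2)
      (fun h => hh₁₂ (Prod.mk.inj h).2) c₀ (by rw [hc]; rfl) T₀ hcm hprim b hanti hann hb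
  refine ⟨Φ, φ₀, X, ι, ϑ, H1, H2, H3, H4, ?_, H6⟩
  rw [H5, Fintype.card_prod]

/-- **A SEMIDIRECT PRODUCT `N ⋊ Γ₀` WITH `|N| ≥ 3` OVER A CERTIFIED-BAD `Γ₀` IS BAD** (any action `φ : Γ₀ →* MulAut N`;
complex conjugation `inr c₀` in the complement): `K` carries a simple degenerate abelian variety of dimension `|N|·|Γ₀|/2`
with CM by `K`. [cite: Kubota1965, §2 and §4 Lemma 2] [cite: Shimura1998, §6.2 Thm. 3 and §8.2 Prop. 26]
[cite: Gordon1999HodgeAVSurvey, Thm. 6.4 and §9.3] -/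
theorem exists_simple_degenerate_semidirect_of_certificate {N Γ₀ : Type*} [Group N] [Fintype N] [DecidableEq N]
    [Group Γ₀] [Fintype Γ₀] [DecidableEq Γ₀] {φ : Γ₀ →* MulAut N} [Fintype (N ⋊[φ] Γ₀)] (hN : 2 < Fintype.card N)
    (e : (K ≃ₐ[ℚ] K) ≃* N ⋊[φ] Γ₀) (c₀ : Γ₀)
    (hc : e ((IsCMField.complexConj K).restrictScalars ℚ) = SemidirectProduct.inr c₀) (T₀ : Finset Γ₀)
    (hcm : ∀ x : Γ₀, x ∈ T₀ ↔ c₀ * x ∉ T₀) (hprim : ∀ v : Γ₀, v ≠ 1 → ∃ w : Γ₀, ¬ (w ∈ T₀ ↔ v * w ∈ T₀))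
    (b : Γ₀ → ℤ) (hanti : ∀ y, b (c₀ * y) = -b y) (hann : ∀ g : Γ₀, ∑ s ∈ T₀, b (s * g) = 0) (hb : ∃ y, b y ≠ 0) :
    ∃ (Φ : CMType K) (φ₀ : K →+* ℂ) (X : AbelianVariety ℂ) (ι : 𝓞 K →+* End X)
      (ϑ : K →+* Module.End ℂ (complexBetti X.X 1)),
      IsPrimitive (ℂ ≃+* ℂ) Φ.1 φ₀ ∧ ¬ IsNondegenerate Φ ∧ IsCMTypeRealisation Φ X ι ϑ ∧ X.IsSimple ∧
      X.dim = Fintype.card N * Fintype.card Γ₀ / 2 ∧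
      ∃ m p : ℕ, ∃ y : complexBetti (⨁ fun _ : Fin m => X).X (2 * p), IsRationalClass y ∧
        IsOfHodgeType (⨁ fun _ : Fin m => X).dim (⨁ fun _ : Fin m => X).X (2 * p) p p y ∧
        y ∉ divisorClassesSpan (⨁ fun _ : Fin m => X).X (⨁ fun _ : Fin m => X).dim p := by
  obtain ⟨a₁, a₂, ha₁, ha₂, ha₁₂⟩ : ∃ a₁ a₂ : N, a₁ ≠ 1 ∧ a₂ ≠ 1 ∧ a₁ ≠ a₂ := by
    obtain ⟨a, b, c, hab, hac, hbc⟩ := Fintype.two_lt_card_iff.1 hN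
    by_cases ha : a = 1
    · exact ⟨b, c, fun h => hab (ha.trans h.symm), fun h => hac (ha.trans h.symm), hbc⟩
    · by_cases hb : b = 1
      · exact ⟨a, c, ha, fun h => hbc (hb.trans h.symm), hac⟩
      · exact ⟨a, b, ha, hb, hab⟩
  obtain ⟨Φ, φ₀, X, ι, ϑ, H1, H2, H3, H4, H5, H6⟩ :=
    exists_simple_degenerate_of_split_certificate e SemidirectProduct.rightHom SemidirectProduct.inr
      SemidirectProduct.rightHom_inr (n₁ := SemidirectProduct.inl a₁) (n₂ := SemidirectProduct.inl a₂)
      (SemidirectProduct.rightHom_inl a₁) (SemidirectProduct.rightHom_inl a₂)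
      (fun h => ha₁ (SemidirectProduct.inl_injective (h.trans (map_one _).symm)))
      (fun h => ha₂ (SemidirectProduct.inl_injective (h.trans (map_one _).symm)))
      (fun h => ha₁₂ (SemidirectProduct.inl_injective h)) c₀ hc T₀ hcm hprim b hanti hann hb
  refine ⟨Φ, φ₀, X, ι, ϑ, H1, H2, H3, H4, ?_, H6⟩
  rw [H5, Fintype.card_congr SemidirectProduct.equivProd, Fintype.card_prod]

end Field

end Summit.HodgeConjecture.CorCM.GaloisModels

end
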